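import Literature.NumberTheory.LFunctions.ThetaChainFreeCheck
import HarnessLib

/-!
# Schoenfeld's `θ`-bound on `[599, 10⁸]` by kernel computation: data-free run, chunk 20 of 35

Topic: `Literature/NumberTheory/LFunctions`. Pure proof file (a kernel computation; nothing is
asserted, no definition). The theorems below evaluate `ThetaChain.runFree` — together `150000`
data-free steps of the certified `θ`-chain (`ThetaChain.stepFree`, `ThetaChainFreeCheck.lean`: the
next prime found and certified by two gcds with the primorials of the odd primes `≤ 2999` and in
`(2999, 10007]`, the enclosures of `log p` and `θ(p)`, and the two comparisons behind
`|θ(x) − x| ≤ √x log² x/(8π)`) — from the state at the prime `57910103` to the state at the prime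
`60595433`. Soundness: `ThetaChain.runFree_sound`; assembly of the 35 chunks: `ThetaUpTo1e8.lean`.
The expected states were obtained by evaluating a twin of the same function outside the kernel
(validated bit-for-bit on the tree's chunk `ThetaChainRun.xrun14`). Declarations of `5·10⁴` steps
(about `70 s` of kernel time each; the kernel's evaluation is linear within a declaration of this size),
`decide +kernel`, standard axioms only (`maxHeartbeats 0` lifts the deterministic time-out).

## References

* L. Schoenfeld, *Sharper bounds for the Chebyshev functions θ(x) and ψ(x). II*, Math. Comp. 30
  (1976), 337–360, Thm. 10 (6.3). [Schoenfeld1976]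
* J. B. Rosser, L. Schoenfeld, *Approximate formulas for some functions of prime numbers*,
  Illinois J. Math. 6 (1962), 64–94, Thms. 18–19 (`θ`-tables to `10⁸`). [RosserSchoenfeld1962]
-/

namespace Literature.NumberTheory.LFunctions.ThetaChainRun

open ThetaChain

set_option maxHeartbeats 0 in
/-- **Data-free certified `θ`-run, chunk 20a** (steps `2850001`–`2900000` after `8886113`: 50000 primes,
`57910103` to `58803299`). [cite: Schoenfeld1976, Thm. 10 (6.3)] -/
theorem frun20a :
    runFree 50000
      ⟨57910103, 21608826593087406404559209, 21608826593087882080185766, 69998989963260865341205263544169, 69998989963262504090065044295458⟩ =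
    some ⟨58803299, 21627330531263071870414766, 21627330531263547546992708, 71079895531130783412353565290071, 71079895531132445945018458850825⟩ := by
  decide +kernel

set_option maxHeartbeats 0 in
/-- **Data-free certified `θ`-run, chunk 20b** (steps `2900001`–`2950000` after `8886113`: 50000 primes,
`58803299` to `59700131`). [cite: Schoenfeld1976, Thm. 10 (6.3)] -/
theorem frun20b :
    runFree 50000
      ⟨58803299, 21627330531263071870414766, 21627330531263547546992708, 71079895531130783412353565290071, 71079895531132445945018458850825⟩ =
    some ⟨59700131, 21645629141866846815587814, 21645629141867322493117221, 72161720515720150058149538664603, 72161720515721836374667115805967⟩ := by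
  decide +kernel

set_option maxHeartbeats 0 in
/-- **Data-free certified `θ`-run, chunk 20c** (steps `2950001`–`3000000` after `8886113`: 50000 primes,
`59700131` to `60595433`). [cite: Schoenfeld1976, Thm. 10 (6.3)] -/
theorem frun20c :
    runFree 50000
      ⟨59700131, 21645629141866846815587814, 21645629141867322493117221, 72161720515720150058149538664603, 72161720515721836374667115805967⟩ =
    some ⟨60595433, 21663624380478738296445026, 21663624380479213974925688, 73244452711406605854282034792990, 73244452711408315954699862491899⟩ := by
  decide +kernel

end Literature.NumberTheory.LFunctions.ThetaChainRun
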